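import Summits.Ventures.Crystal3D.Theorems.StickyWulffConstantTextureLiminfTexShadowLevelReachCoSlot
import Summits.Ventures.Crystal3D.Theorems.StickyWulffConstantTextureLiminfTexShadowLevelReachCutSetShape
import Summits.Ventures.Crystal3D.Theorems.StickyWulffConstantCoaxialWallLawBarlowPlateSources
import Summits.Ventures.Crystal3D.Theorems.StickyWulffConstantCoaxialWallLawEndRowRootDefs
import HarnessLib

/-!
# The ROOT-CLASS census from a launch set and the BORN lines — WITH THE ROOT-CLASS END MOVE (the mover READ in the launch frame)
# (lane T, crux `TextureLiminfV5`, stmt-Ventures-23912, registered stub `stub_terraceCensus`; (β) assembly — cf-p1 RULING (cccv): born families poolable under the SAME row)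

HONEST FRAMING. Venture `Summits/Ventures/Crystal3D` (cell `crystal3d-full`), route `route-Ventures-StickyWulffConstant`, helper `--supports` the law-v5
crux `TextureLiminfV5` (stmt-Ventures-23912), lane T, mechanism (β).  Census-free, certificate-free; `KissingGap δ`, `KissingClassification δ` BY NAME; F-C1 not moved.

THE POINT.  `rootClass_endPairs_launch_shape`, `born_endPairs_launch_shape`, `bornMoving_endPairs_launch_shape` (…LevelReachBornShape, p747337) VERBATIM —
same hypotheses, same proofs over `word_family_endPairs_launch_cuts_shape` — with the internal all-cut invariant STRENGTHENED exactly as in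
…LevelReachHexagonBarlowRoot (p748882): «root class, ball and predecessor present, the predecessor READS A STRAIGHT MOVE in the launch frame (FULL / twin GLIDE /
NARROW under `v2`) and has ITS predecessor present» — free one step after a launch (the launch clause is that reading), carried by straight moves, crosses
vacuous (every crossing letter is cut).  Read back at the end ball, the exported shape clause becomes the ROOT-CLASS END MOVE in the launch frame `F []` with
root direction `c = F [] (u [])`:
`bq.1 − c ∈ X ∧ bq.2 = bq.1 − c ∧ ¬ IsMoving X ver (F []) c bq.1 ∧ bq.2 − c ∈ X ∧ IsEndMove X ver (F []) c bq.2 bq.1`.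
So a born family launched in a lamella frame `A` along `c` is a set of pairs each of which is (i) an `IsRootEndPair X ver ⟨A, {A⁻¹ c}⟩` pair of its own
root system (`isRootEndPair_of_rootMove`), and (ii) an `IsEndPairA X ver S₁ S₂` pair of the two PLATE systems as soon as the class `(A, c)` is PRESENTED in one of
their word nets, `S₁.Adm A c ∨ S₂.Adm A c` (`isEndPairA_of_rootMove`) — the presentation obligation of the assembly under cf-p1 (cccv) (census object = the two
plate systems with their full word nets; born families of the filling's lamellae enter as classes of those nets).  Families with root directions of opposite
vertical sign stay disjoint by `bq.2 = bq.1 − c`.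
* `rootClass_endPairs_launch_root`, **`born_endPairs_launch_root`**, `bornMoving_endPairs_launch_root`, `isRootEndPair_of_rootMove`, `isEndPairA_of_rootMove`.
WHAT THIS IS NOT: any lower bound on the number of born lines (born SUPPLY), the presentation `Adm` itself, the pooling, any certificate; F-C1 not moved.
-/

noncomputable section

namespace Summit.Ventures.Crystal3D.Theorems

open Summit.Ventures.Crystal3D Finset
open Summit.Ventures.Crystal3D.Cruxes.TextureLiminf.TexShadow (E3)
open scoped InnerProductSpace

section RootLaunch

variable {X : Finset E3} {F : List E3 → (E3 ≃ₗᵢ[ℝ] E3)} {u : List E3 → E3} {WF : List E3 → Prop} {next : List E3 → E3 → List E3}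
  {P' P₂ : Finset E3} {R₀ h ρ : ℝ}

open scoped Classical in
/-- **The root-class census from a launch set, every crossing cut.**  Word data as in lane F's census; `C` cuts EVERY upward crossing letter of the root
(`hC`, `hCall`); root-frame top exclusion `hPexcl0root`; launch set `L` of straight-moving root states with predecessor (`hLsrc`, no invariant clause) and
`p + c ∉ L` (`hLstep`); core / sealing verbatim.  Conclusion: `#L_window ≤ #T + #CUT + #REL₀ + 220·(#rim_top + #rim_bot)`, `REL₀` the STRAIGHT relaunches
only (predecessor a straight-moving window ball with its own predecessor present), `T` with lane F's exported properties (the end ball a certified root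
state). -/
theorem rootClass_endPairs_launch_root (ver : WordVersion) {δ : ℝ} (hg : KissingGap δ) (hc : KissingClassification δ)
    (hX : ∀ p ∈ X, ∀ q ∈ X, p ≠ q → 1 ≤ dist p q)
    (hFc : ∀ μ κ, F (μ :: κ) = ((ℝ ∙ μ)ᗮ.reflection).trans (F κ))
    (hu : ∀ κ, u κ ∈ fccSlots) (huc : ∀ μ κ, u (μ :: κ) = -u κ)
    (hWF0 : WF [])
    (hWFc : ∀ μ κ, WF (μ :: κ) ↔ (WF κ ∧ ‖μ‖ = 1 ∧
      (∀ w ∈ fccSlots, ⟪w, μ⟫_ℝ = 0 ∨ ⟪w, μ⟫_ℝ = Real.sqrt (2 / 3) ∨ ⟪w, μ⟫_ℝ = -Real.sqrt (2 / 3)) ∧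
      ⟪u κ, μ⟫_ℝ = Real.sqrt (2 / 3) ∧ ∀ μ' κ', κ = μ' :: κ' → μ' ≠ -μ))
    (hnext_pop : ∀ μ κ' (m : E3), (F (μ :: κ')).symm m = -μ → next (μ :: κ') m = κ')
    (hnext_push : ∀ κ (m : E3), (∀ μ κ', κ = μ :: κ' → (F κ).symm m ≠ -μ) → next κ m = (F κ).symm m :: κ)
    (C : E3 → Prop) (hC : ∀ μ, C μ → ⟪u [], μ⟫_ℝ = Real.sqrt (2 / 3))
    (hCall : ∀ m, IsMenuNormal (F []) m → ⟪F [] (u []), m⟫_ℝ = Real.sqrt (2 / 3) → C ((F []).symm m))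
    (hPexcl0root : ∀ b : E3, b ∈ P₂ →
      (∃ a ∈ fccSlots, ∃ a' ∈ fccSlots, ∃ a'' ∈ fccSlots,
        ⟪a, a'⟫_ℝ = 1 / 2 ∧ ⟪a, a''⟫_ℝ = 1 / 2 ∧ ⟪a', a''⟫_ℝ = 1 / 2 ∧
        b + F [] a ∈ X ∧ b + F [] a' ∈ X ∧ b + F [] a'' ∈ X) → False)
    (hup : 0 < (F [] (u [])) 2) (hR₀ : 3 ≤ R₀) (hρ : R₀ ≤ ρ)
    (L : Finset E3)
    (hLsrc : ∀ p ∈ L, p ∈ X ∧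
      (∃ a ∈ fccSlots, ∃ a' ∈ fccSlots, ∃ a'' ∈ fccSlots,
        ⟪a, a'⟫_ℝ = 1 / 2 ∧ ⟪a, a''⟫_ℝ = 1 / 2 ∧ ⟪a', a''⟫_ℝ = 1 / 2 ∧
        p + F [] a ∈ X ∧ p + F [] a' ∈ X ∧ p + F [] a'' ∈ X) ∧
      p - F [] (u []) ∈ X ∧
      (IsFull X (F []) p ∨ (∃ m, IsTwinReading X (F []) m p ∧ ⟪F [] (u []), m⟫_ℝ = 0) ∨
        (ver = WordVersion.v2 ∧ IsNarrow X (F []) (F [] (u [])) p)))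
    (hLstep : ∀ p ∈ L, p + F [] (u []) ∉ L)
    (hP'top : ∀ p ∈ P', p 2 ≤ -R₀ - 1)
    (hstd : ∀ κ, WF κ → ∀ p ∈ P', (∃ a ∈ fccSlots, ∃ a' ∈ fccSlots, ∃ a'' ∈ fccSlots,
        ⟪a, a'⟫_ℝ = 1 / 2 ∧ ⟪a, a''⟫_ℝ = 1 / 2 ∧ ⟪a', a''⟫_ℝ = 1 / 2 ∧
        p + F κ a ∈ X ∧ p + F κ a' ∈ X ∧ p + F κ a'' ∈ X) → F κ (u κ) = F [] (u []))
    (hsealB : ∀ s ∈ X, s ∉ P' → -R₀ - 1 - 1 ≤ s 2 → s 2 < -R₀ - 1 → s 0 ^ 2 + s 1 ^ 2 ≤ (ρ - 1) ^ 2 → False)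
    (hP₂seal : ∀ s ∈ X, h + R₀ + 1 ≤ s 2 → s 2 ≤ h + R₀ + 1 + 1 → s 0 ^ 2 + s 1 ^ 2 ≤ (ρ - 2) ^ 2 → s ∈ P₂) :
    ∃ T : Finset (E3 × E3),
      (L.filter fun p => -R₀ - 1 < (p + F [] (u [])) 2 ∧ (p + F [] (u [])) 2 < h + R₀ + 1).card ≤
        T.card +
        (X.filter fun b => -R₀ - 1 ≤ b 2 ∧ b 2 < h + R₀ + 1 ∧ (∃ μ, C μ ∧ IsTwinReading X (F []) (F [] μ) b) ∧ b - F [] (u []) ∈ X).card +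
        (L.filter fun p => -R₀ - 1 ≤ (p - F [] (u [])) 2 ∧ (p - F [] (u [])) 2 < h + R₀ + 1 ∧ p - F [] (u []) - F [] (u []) ∈ X ∧
            (IsFull X (F []) (p - F [] (u [])) ∨
              (∃ m, IsTwinReading X (F []) m (p - F [] (u [])) ∧ ⟪F [] (u []), m⟫_ℝ = 0) ∨
              (ver = WordVersion.v2 ∧ IsNarrow X (F []) (F [] (u [])) (p - F [] (u []))))).card +
        220 * (X.filter fun s => h + R₀ + 1 ≤ s 2 ∧ s 2 ≤ h + R₀ + 1 + 1 ∧ (ρ - 2) ^ 2 < s 0 ^ 2 + s 1 ^ 2).card +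
        220 * (X.filter fun s => -R₀ - 1 - 1 ≤ s 2 ∧ s 2 < -R₀ - 1 ∧ (ρ - 1) ^ 2 < s 0 ^ 2 + s 1 ^ 2).card ∧
      (∀ bq ∈ T, bq.1 ∈ X ∧ bq.2 ∈ X ∧ dist bq.1 bq.2 = 1 ∧ -R₀ - 1 ≤ bq.1 2 ∧ bq.1 2 < h + R₀ + 1) ∧
      (∀ bq ∈ T, (X.filter fun q => dist bq.1 q = 1).card ≤ 11 ∨
        ∃ z₁ ∈ X, ∃ z₂ ∈ X, z₁ ≠ z₂ ∧ dist bq.1 z₁ = 1 ∧ dist bq.1 z₂ = 1 ∧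
          (X.filter fun q => dist z₁ q = 1).card ≤ 11 ∧ (X.filter fun q => dist z₂ q = 1).card ≤ 11) ∧
      (∀ bq ∈ T, bq.1 - F [] (u []) ∈ X ∧ bq.2 = bq.1 - F [] (u []) ∧ ¬ IsMoving X ver (F []) (F [] (u [])) bq.1 ∧
        bq.2 - F [] (u []) ∈ X ∧ IsEndMove X ver (F []) (F [] (u [])) bq.2 bq.1) := by
  set P : E3 × List E3 → Prop := fun v => v.2 = [] ∧ (v.1 ∈ X ∧ v.1 - F v.2 (u v.2) ∈ X) ∧
    (IsFull X (F v.2) (v.1 - F v.2 (u v.2)) ∨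
      (∃ m, IsTwinReading X (F v.2) m (v.1 - F v.2 (u v.2)) ∧ ⟪F v.2 (u v.2), m⟫_ℝ = 0) ∨
      (ver = WordVersion.v2 ∧ IsNarrow X (F v.2) (F v.2 (u v.2)) (v.1 - F v.2 (u v.2)))) ∧
    v.1 - F v.2 (u v.2) - F v.2 (u v.2) ∈ X with hPdef
  have hPstraight : ∀ (b : E3) (κ : List E3), WF κ →
      (IsFull X (F κ) b ∨ (∃ m, IsTwinReading X (F κ) m b ∧ ⟪F κ (u κ), m⟫_ℝ = 0) ∨
        (ver = WordVersion.v2 ∧ IsNarrow X (F κ) (F κ (u κ)) b)) → P (b, κ) → P (b + F κ (u κ), κ) := by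
    rintro b κ - hmv ⟨hnil, hb, -, -⟩
    exact ⟨hnil, predInv_straight hu hmv hb, by rw [add_sub_cancel_right]; exact hmv, by rw [add_sub_cancel_right]; exact hb.2⟩
  have hPcross : ∀ (b : E3) (κ : List E3) (m : E3), WF κ → WF (next κ m) → IsTwinReading X (F κ) m b →
      ⟪F κ (u κ), m⟫_ℝ = Real.sqrt (2 / 3) → (κ ≠ [] ∨ ¬ C ((F []).symm m)) → P (b, κ) → P (b + F (next κ m) (u (next κ m)), next κ m) := by
    rintro b κ m - - htd hdm hoff ⟨hnil, -⟩
    exfalso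
    have hnil' : κ = [] := hnil
    subst hnil'
    rcases hoff with h0 | h0
    · exact h0 rfl
    · exact h0 (hCall m htd.1 hdm)
  have hPexcl0 : ∀ (b : E3) (κ : List E3), WF κ → P (b, κ) → b ∈ P₂ →
      (∃ a ∈ fccSlots, ∃ a' ∈ fccSlots, ∃ a'' ∈ fccSlots,
        ⟪a, a'⟫_ℝ = 1 / 2 ∧ ⟪a, a''⟫_ℝ = 1 / 2 ∧ ⟪a', a''⟫_ℝ = 1 / 2 ∧
        b + F κ a ∈ X ∧ b + F κ a' ∈ X ∧ b + F κ a'' ∈ X) → False := by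
    rintro b κ - ⟨hnil, -⟩ hb htri
    have hnil' : κ = [] := hnil
    subst hnil'
    exact hPexcl0root b hb htri
  have hLsrc' : ∀ p ∈ L, p ∈ X ∧
      (∃ a ∈ fccSlots, ∃ a' ∈ fccSlots, ∃ a'' ∈ fccSlots,
        ⟪a, a'⟫_ℝ = 1 / 2 ∧ ⟪a, a''⟫_ℝ = 1 / 2 ∧ ⟪a', a''⟫_ℝ = 1 / 2 ∧
        p + F [] a ∈ X ∧ p + F [] a' ∈ X ∧ p + F [] a'' ∈ X) ∧
      p - F [] (u []) ∈ X ∧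
      (IsFull X (F []) p ∨ (∃ m, IsTwinReading X (F []) m p ∧ ⟪F [] (u []), m⟫_ℝ = 0) ∨
        (ver = WordVersion.v2 ∧ IsNarrow X (F []) (F [] (u [])) p)) ∧
      P (p + F [] (u []), []) := by
    intro p hp
    obtain ⟨hpX, hface, hpred, hmv⟩ := hLsrc p hp
    exact ⟨hpX, hface, hpred, hmv, rfl, predInv_straight hu hmv ⟨hpX, hpred⟩, by rw [add_sub_cancel_right]; exact hmv,
      by rw [add_sub_cancel_right]; exact hpred⟩
  obtain ⟨T, hbound, h1, h2, h3, -⟩ := word_family_endPairs_launch_cuts_shape ver hg hc hX hFc hu huc hWF0 hWFc hnext_pop hnext_push C hC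
    hPstraight hPcross hPexcl0 hup hR₀ hρ L hLsrc' hLstep hP'top hstd hsealB hP₂seal
  refine ⟨T, hbound.trans ?_, h1, h2, ?_⟩
  · refine Nat.add_le_add_right (Nat.add_le_add_right (Nat.add_le_add (Nat.add_le_add_left (card_le_card fun b hb => ?_) _)
      (card_le_card fun p hp => ?_)) _) _
    · -- drop the invariant clause from the cut term
      simp only [Finset.mem_filter] at hb ⊢
      exact ⟨hb.1, hb.2.1, hb.2.2.1, hb.2.2.2.1, hb.2.2.2.2.2⟩
    · -- the relaunch term: the cross case is vacuous (every crossing letter is cut), the straight case reads the predecessor invariant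
      simp only [Finset.mem_filter] at hp ⊢
      obtain ⟨hpL, hrel⟩ := hp
      rcases hrel with ⟨⟨-, ⟨-, hpp⟩, -, -⟩, hlo, hhi, hmv⟩ | ⟨μ, hwf, hne, -, -, -, m, -, -, -⟩
      · exact ⟨hpL, hlo, hhi, hpp, hmv⟩
      · obtain ⟨-, hμ1, hμmenu, hwμ, -⟩ := (hWFc μ []).1 hwf
        exact absurd (hCall (F [] μ) ⟨by rw [LinearIsometryEquiv.norm_map, hμ1], fun w hw => by
          rw [LinearIsometryEquiv.inner_map_map]; exact hμmenu w hw⟩ (by rw [LinearIsometryEquiv.inner_map_map, hwμ]))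
          (by rw [LinearIsometryEquiv.symm_apply_apply]; exact hne)
  · -- the ROOT-CLASS end move: the invariant forces `κ = []` and carries the mover's straight reading and predecessor
    intro bq hbq
    obtain ⟨κ, -, ⟨hnil, ⟨-, hpred⟩, hread, hpp⟩, hshape, hnm⟩ := h3 bq hbq
    have hnil' : κ = [] := hnil
    subst hnil'
    rw [← hshape] at hread hpp
    refine ⟨hpred, hshape, hnm, hpp, Or.inl ⟨?_, by rw [hshape, sub_add_cancel], hnm⟩⟩
    rcases hread with hfull | hgl | hnar
    · exact Or.inl hfull
    · exact Or.inr (Or.inr hgl)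
    · exact Or.inr (Or.inl hnar)

open scoped Classical in
/-- **BORN LINES have no relaunch term.**  A launch set of straight-moving root states (FULL in the root frame, say the first trackable ball above an
incoherent patch) whose predecessor `p − c` is present but is NOT itself a straight-moving state with its own predecessor present (`hborn`) is never
stepped onto by a tracked walk: with every crossing letter cut, `#L_window ≤ #T + #CUT + 220·(#rim_top + #rim_bot)`. -/
theorem born_endPairs_launch_root (ver : WordVersion) {δ : ℝ} (hg : KissingGap δ) (hc : KissingClassification δ)
    (hX : ∀ p ∈ X, ∀ q ∈ X, p ≠ q → 1 ≤ dist p q)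
    (hFc : ∀ μ κ, F (μ :: κ) = ((ℝ ∙ μ)ᗮ.reflection).trans (F κ))
    (hu : ∀ κ, u κ ∈ fccSlots) (huc : ∀ μ κ, u (μ :: κ) = -u κ)
    (hWF0 : WF [])
    (hWFc : ∀ μ κ, WF (μ :: κ) ↔ (WF κ ∧ ‖μ‖ = 1 ∧
      (∀ w ∈ fccSlots, ⟪w, μ⟫_ℝ = 0 ∨ ⟪w, μ⟫_ℝ = Real.sqrt (2 / 3) ∨ ⟪w, μ⟫_ℝ = -Real.sqrt (2 / 3)) ∧
      ⟪u κ, μ⟫_ℝ = Real.sqrt (2 / 3) ∧ ∀ μ' κ', κ = μ' :: κ' → μ' ≠ -μ))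
    (hnext_pop : ∀ μ κ' (m : E3), (F (μ :: κ')).symm m = -μ → next (μ :: κ') m = κ')
    (hnext_push : ∀ κ (m : E3), (∀ μ κ', κ = μ :: κ' → (F κ).symm m ≠ -μ) → next κ m = (F κ).symm m :: κ)
    (C : E3 → Prop) (hC : ∀ μ, C μ → ⟪u [], μ⟫_ℝ = Real.sqrt (2 / 3))
    (hCall : ∀ m, IsMenuNormal (F []) m → ⟪F [] (u []), m⟫_ℝ = Real.sqrt (2 / 3) → C ((F []).symm m))
    (hPexcl0root : ∀ b : E3, b ∈ P₂ →
      (∃ a ∈ fccSlots, ∃ a' ∈ fccSlots, ∃ a'' ∈ fccSlots,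
        ⟪a, a'⟫_ℝ = 1 / 2 ∧ ⟪a, a''⟫_ℝ = 1 / 2 ∧ ⟪a', a''⟫_ℝ = 1 / 2 ∧
        b + F [] a ∈ X ∧ b + F [] a' ∈ X ∧ b + F [] a'' ∈ X) → False)
    (hup : 0 < (F [] (u [])) 2) (hR₀ : 3 ≤ R₀) (hρ : R₀ ≤ ρ)
    -- the BORN launch set: full root-frame balls with predecessor present, the predecessor NOT a trackable straight mover
    (L : Finset E3)
    (hborn : ∀ p ∈ L, p ∈ X ∧ IsFull X (F []) p ∧ p - F [] (u []) ∈ X ∧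
      ¬ (p - F [] (u []) - F [] (u []) ∈ X ∧
        (IsFull X (F []) (p - F [] (u [])) ∨ (∃ m, IsTwinReading X (F []) m (p - F [] (u [])) ∧ ⟪F [] (u []), m⟫_ℝ = 0) ∨
          (ver = WordVersion.v2 ∧ IsNarrow X (F []) (F [] (u [])) (p - F [] (u []))))))
    (hP'top : ∀ p ∈ P', p 2 ≤ -R₀ - 1)
    (hstd : ∀ κ, WF κ → ∀ p ∈ P', (∃ a ∈ fccSlots, ∃ a' ∈ fccSlots, ∃ a'' ∈ fccSlots,
        ⟪a, a'⟫_ℝ = 1 / 2 ∧ ⟪a, a''⟫_ℝ = 1 / 2 ∧ ⟪a', a''⟫_ℝ = 1 / 2 ∧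
        p + F κ a ∈ X ∧ p + F κ a' ∈ X ∧ p + F κ a'' ∈ X) → F κ (u κ) = F [] (u []))
    (hsealB : ∀ s ∈ X, s ∉ P' → -R₀ - 1 - 1 ≤ s 2 → s 2 < -R₀ - 1 → s 0 ^ 2 + s 1 ^ 2 ≤ (ρ - 1) ^ 2 → False)
    (hP₂seal : ∀ s ∈ X, h + R₀ + 1 ≤ s 2 → s 2 ≤ h + R₀ + 1 + 1 → s 0 ^ 2 + s 1 ^ 2 ≤ (ρ - 2) ^ 2 → s ∈ P₂) :
    ∃ T : Finset (E3 × E3),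
      (L.filter fun p => -R₀ - 1 < (p + F [] (u [])) 2 ∧ (p + F [] (u [])) 2 < h + R₀ + 1).card ≤
        T.card +
        (X.filter fun b => -R₀ - 1 ≤ b 2 ∧ b 2 < h + R₀ + 1 ∧ (∃ μ, C μ ∧ IsTwinReading X (F []) (F [] μ) b) ∧ b - F [] (u []) ∈ X).card +
        220 * (X.filter fun s => h + R₀ + 1 ≤ s 2 ∧ s 2 ≤ h + R₀ + 1 + 1 ∧ (ρ - 2) ^ 2 < s 0 ^ 2 + s 1 ^ 2).card +
        220 * (X.filter fun s => -R₀ - 1 - 1 ≤ s 2 ∧ s 2 < -R₀ - 1 ∧ (ρ - 1) ^ 2 < s 0 ^ 2 + s 1 ^ 2).card ∧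
      (∀ bq ∈ T, bq.1 ∈ X ∧ bq.2 ∈ X ∧ dist bq.1 bq.2 = 1 ∧ -R₀ - 1 ≤ bq.1 2 ∧ bq.1 2 < h + R₀ + 1) ∧
      (∀ bq ∈ T, (X.filter fun q => dist bq.1 q = 1).card ≤ 11 ∨
        ∃ z₁ ∈ X, ∃ z₂ ∈ X, z₁ ≠ z₂ ∧ dist bq.1 z₁ = 1 ∧ dist bq.1 z₂ = 1 ∧
          (X.filter fun q => dist z₁ q = 1).card ≤ 11 ∧ (X.filter fun q => dist z₂ q = 1).card ≤ 11) ∧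
      (∀ bq ∈ T, bq.1 - F [] (u []) ∈ X ∧ bq.2 = bq.1 - F [] (u []) ∧ ¬ IsMoving X ver (F []) (F [] (u [])) bq.1 ∧
        bq.2 - F [] (u []) ∈ X ∧ IsEndMove X ver (F []) (F [] (u [])) bq.2 bq.1) := by
  have hLsrc : ∀ p ∈ L, p ∈ X ∧
      (∃ a ∈ fccSlots, ∃ a' ∈ fccSlots, ∃ a'' ∈ fccSlots,
        ⟪a, a'⟫_ℝ = 1 / 2 ∧ ⟪a, a''⟫_ℝ = 1 / 2 ∧ ⟪a', a''⟫_ℝ = 1 / 2 ∧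
        p + F [] a ∈ X ∧ p + F [] a' ∈ X ∧ p + F [] a'' ∈ X) ∧
      p - F [] (u []) ∈ X ∧
      (IsFull X (F []) p ∨ (∃ m, IsTwinReading X (F []) m p ∧ ⟪F [] (u []), m⟫_ℝ = 0) ∨
        (ver = WordVersion.v2 ∧ IsNarrow X (F []) (F [] (u [])) p)) := by
    intro p hp
    obtain ⟨hpX, hfull, hpred, -⟩ := hborn p hp
    exact ⟨hpX, face_of_isFull (F []) hfull, hpred, Or.inl hfull⟩
  -- a full ball's successor is never a born launch (its predecessor would be a trackable straight mover)
  have hLstep : ∀ p ∈ L, p + F [] (u []) ∉ L := by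
    intro p hp hmem
    obtain ⟨hpX, hfull, hpred, -⟩ := hborn p hp
    obtain ⟨-, -, -, hno⟩ := hborn _ hmem
    rw [add_sub_cancel_right] at hno
    exact hno ⟨hpred, Or.inl hfull⟩
  obtain ⟨T, hbound, h1, h2, h3⟩ := rootClass_endPairs_launch_root ver hg hc hX hFc hu huc hWF0 hWFc hnext_pop hnext_push C hC hCall
    hPexcl0root hup hR₀ hρ L hLsrc hLstep hP'top hstd hsealB hP₂seal
  refine ⟨T, hbound.trans ?_, h1, h2, h3⟩
  -- the straight relaunch term is EMPTY for born launches
  rw [Finset.card_eq_zero.2 ((Finset.filter_eq_empty_iff (s := L)).2 ?_), add_zero]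
  intro p hp hrel
  obtain ⟨-, -, -, hno⟩ := hborn p hp
  exact hno ⟨hrel.2.2.1, hrel.2.2.2⟩

open scoped Classical in
/-- **BORN LINES with any straight-moving launch ball** (FULL, or a GLIDE reading, or — version `v2` — NARROW): the born basal GLIDE lines of an hcp-like
lamella are the ones that exist on edge-on cells (memo §4(c)).  Launch balls: in `X`, straight-moving along the root, an occupied root-frame face, predecessor
present but NOT a trackable straight mover with its own predecessor (`hborn`).  No relaunch term: `#L_window ≤ #T + #CUT + 220·(#rim_top + #rim_bot)`. -/
theorem bornMoving_endPairs_launch_root (ver : WordVersion) {δ : ℝ} (hg : KissingGap δ) (hc : KissingClassification δ)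
    (hX : ∀ p ∈ X, ∀ q ∈ X, p ≠ q → 1 ≤ dist p q)
    (hFc : ∀ μ κ, F (μ :: κ) = ((ℝ ∙ μ)ᗮ.reflection).trans (F κ))
    (hu : ∀ κ, u κ ∈ fccSlots) (huc : ∀ μ κ, u (μ :: κ) = -u κ)
    (hWF0 : WF [])
    (hWFc : ∀ μ κ, WF (μ :: κ) ↔ (WF κ ∧ ‖μ‖ = 1 ∧
      (∀ w ∈ fccSlots, ⟪w, μ⟫_ℝ = 0 ∨ ⟪w, μ⟫_ℝ = Real.sqrt (2 / 3) ∨ ⟪w, μ⟫_ℝ = -Real.sqrt (2 / 3)) ∧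
      ⟪u κ, μ⟫_ℝ = Real.sqrt (2 / 3) ∧ ∀ μ' κ', κ = μ' :: κ' → μ' ≠ -μ))
    (hnext_pop : ∀ μ κ' (m : E3), (F (μ :: κ')).symm m = -μ → next (μ :: κ') m = κ')
    (hnext_push : ∀ κ (m : E3), (∀ μ κ', κ = μ :: κ' → (F κ).symm m ≠ -μ) → next κ m = (F κ).symm m :: κ)
    (C : E3 → Prop) (hC : ∀ μ, C μ → ⟪u [], μ⟫_ℝ = Real.sqrt (2 / 3))
    (hCall : ∀ m, IsMenuNormal (F []) m → ⟪F [] (u []), m⟫_ℝ = Real.sqrt (2 / 3) → C ((F []).symm m))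
    (hPexcl0root : ∀ b : E3, b ∈ P₂ →
      (∃ a ∈ fccSlots, ∃ a' ∈ fccSlots, ∃ a'' ∈ fccSlots,
        ⟪a, a'⟫_ℝ = 1 / 2 ∧ ⟪a, a''⟫_ℝ = 1 / 2 ∧ ⟪a', a''⟫_ℝ = 1 / 2 ∧
        b + F [] a ∈ X ∧ b + F [] a' ∈ X ∧ b + F [] a'' ∈ X) → False)
    (hup : 0 < (F [] (u [])) 2) (hR₀ : 3 ≤ R₀) (hρ : R₀ ≤ ρ)
    (L : Finset E3)
    (hborn : ∀ p ∈ L, p ∈ X ∧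
      (IsFull X (F []) p ∨ (∃ m, IsTwinReading X (F []) m p ∧ ⟪F [] (u []), m⟫_ℝ = 0) ∨
        (ver = WordVersion.v2 ∧ IsNarrow X (F []) (F [] (u [])) p)) ∧
      (∃ a ∈ fccSlots, ∃ a' ∈ fccSlots, ∃ a'' ∈ fccSlots,
        ⟪a, a'⟫_ℝ = 1 / 2 ∧ ⟪a, a''⟫_ℝ = 1 / 2 ∧ ⟪a', a''⟫_ℝ = 1 / 2 ∧
        p + F [] a ∈ X ∧ p + F [] a' ∈ X ∧ p + F [] a'' ∈ X) ∧
      p - F [] (u []) ∈ X ∧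
      ¬ (p - F [] (u []) - F [] (u []) ∈ X ∧
        (IsFull X (F []) (p - F [] (u [])) ∨ (∃ m, IsTwinReading X (F []) m (p - F [] (u [])) ∧ ⟪F [] (u []), m⟫_ℝ = 0) ∨
          (ver = WordVersion.v2 ∧ IsNarrow X (F []) (F [] (u [])) (p - F [] (u []))))))
    (hP'top : ∀ p ∈ P', p 2 ≤ -R₀ - 1)
    (hstd : ∀ κ, WF κ → ∀ p ∈ P', (∃ a ∈ fccSlots, ∃ a' ∈ fccSlots, ∃ a'' ∈ fccSlots,
        ⟪a, a'⟫_ℝ = 1 / 2 ∧ ⟪a, a''⟫_ℝ = 1 / 2 ∧ ⟪a', a''⟫_ℝ = 1 / 2 ∧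
        p + F κ a ∈ X ∧ p + F κ a' ∈ X ∧ p + F κ a'' ∈ X) → F κ (u κ) = F [] (u []))
    (hsealB : ∀ s ∈ X, s ∉ P' → -R₀ - 1 - 1 ≤ s 2 → s 2 < -R₀ - 1 → s 0 ^ 2 + s 1 ^ 2 ≤ (ρ - 1) ^ 2 → False)
    (hP₂seal : ∀ s ∈ X, h + R₀ + 1 ≤ s 2 → s 2 ≤ h + R₀ + 1 + 1 → s 0 ^ 2 + s 1 ^ 2 ≤ (ρ - 2) ^ 2 → s ∈ P₂) :
    ∃ T : Finset (E3 × E3),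
      (L.filter fun p => -R₀ - 1 < (p + F [] (u [])) 2 ∧ (p + F [] (u [])) 2 < h + R₀ + 1).card ≤
        T.card +
        (X.filter fun b => -R₀ - 1 ≤ b 2 ∧ b 2 < h + R₀ + 1 ∧ (∃ μ, C μ ∧ IsTwinReading X (F []) (F [] μ) b) ∧ b - F [] (u []) ∈ X).card +
        220 * (X.filter fun s => h + R₀ + 1 ≤ s 2 ∧ s 2 ≤ h + R₀ + 1 + 1 ∧ (ρ - 2) ^ 2 < s 0 ^ 2 + s 1 ^ 2).card +
        220 * (X.filter fun s => -R₀ - 1 - 1 ≤ s 2 ∧ s 2 < -R₀ - 1 ∧ (ρ - 1) ^ 2 < s 0 ^ 2 + s 1 ^ 2).card ∧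
      (∀ bq ∈ T, bq.1 ∈ X ∧ bq.2 ∈ X ∧ dist bq.1 bq.2 = 1 ∧ -R₀ - 1 ≤ bq.1 2 ∧ bq.1 2 < h + R₀ + 1) ∧
      (∀ bq ∈ T, (X.filter fun q => dist bq.1 q = 1).card ≤ 11 ∨
        ∃ z₁ ∈ X, ∃ z₂ ∈ X, z₁ ≠ z₂ ∧ dist bq.1 z₁ = 1 ∧ dist bq.1 z₂ = 1 ∧
          (X.filter fun q => dist z₁ q = 1).card ≤ 11 ∧ (X.filter fun q => dist z₂ q = 1).card ≤ 11) ∧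
      (∀ bq ∈ T, bq.1 - F [] (u []) ∈ X ∧ bq.2 = bq.1 - F [] (u []) ∧ ¬ IsMoving X ver (F []) (F [] (u [])) bq.1 ∧
        bq.2 - F [] (u []) ∈ X ∧ IsEndMove X ver (F []) (F [] (u [])) bq.2 bq.1) := by
  have hLsrc : ∀ p ∈ L, p ∈ X ∧
      (∃ a ∈ fccSlots, ∃ a' ∈ fccSlots, ∃ a'' ∈ fccSlots,
        ⟪a, a'⟫_ℝ = 1 / 2 ∧ ⟪a, a''⟫_ℝ = 1 / 2 ∧ ⟪a', a''⟫_ℝ = 1 / 2 ∧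
        p + F [] a ∈ X ∧ p + F [] a' ∈ X ∧ p + F [] a'' ∈ X) ∧
      p - F [] (u []) ∈ X ∧
      (IsFull X (F []) p ∨ (∃ m, IsTwinReading X (F []) m p ∧ ⟪F [] (u []), m⟫_ℝ = 0) ∨
        (ver = WordVersion.v2 ∧ IsNarrow X (F []) (F [] (u [])) p)) := by
    intro p hp
    obtain ⟨hpX, hmv, hface, hpred, -⟩ := hborn p hp
    exact ⟨hpX, hface, hpred, hmv⟩
  have hLstep : ∀ p ∈ L, p + F [] (u []) ∉ L := by
    intro p hp hmem
    obtain ⟨-, hmv, -, hpred, -⟩ := hborn p hp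
    obtain ⟨-, -, -, -, hno⟩ := hborn _ hmem
    rw [add_sub_cancel_right] at hno
    exact hno ⟨hpred, hmv⟩
  obtain ⟨T, hbound, h1, h2, h3⟩ := rootClass_endPairs_launch_root ver hg hc hX hFc hu huc hWF0 hWFc hnext_pop hnext_push C hC hCall
    hPexcl0root hup hR₀ hρ L hLsrc hLstep hP'top hstd hsealB hP₂seal
  refine ⟨T, hbound.trans ?_, h1, h2, h3⟩
  rw [Finset.card_eq_zero.2 ((Finset.filter_eq_empty_iff (s := L)).2 ?_), add_zero]
  intro p hp hrel
  obtain ⟨-, -, -, -, hno⟩ := hborn p hp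
  exact hno ⟨hrel.2.2.1, hrel.2.2.2⟩

end RootLaunch

/-! ### Presentation of a root-class end move: own root system, or a class of the plate systems' word nets -/

/-- **Own root system.**  A root-class end move along `c = S.G₀ r`, `r ∈ S.RT`, with the mover's predecessor present and two payers at the end ball, is an
`IsRootEndPair` of `S` (…EndRowRootDefs). -/
theorem isRootEndPair_of_rootMove {X : Finset E3} {v : WordVersion} {S : PlateSystem} {r b q : E3} (hr : r ∈ S.RT)
    (hq : q ∈ X) (hb : b ∈ X) (hpay : HasTwoPayers X b) (hshape : q = b - S.G₀ r) (hpred : q - S.G₀ r ∈ X)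
    (hmove : IsEndMove X v S.G₀ (S.G₀ r) q b) : IsRootEndPair X v S b q :=
  ⟨hq, hb, hpay, r, hr, by rw [hshape, sub_add_cancel], hpred, hmove⟩

/-- **Presented in a plate system's word net** (the assembly's obligation under cf-p1 (cccv)): if the launch class `(G, c)` is an admissible class of `S₁`
or of `S₂`, a root-class end move along `c` in the frame `G` with predecessor and two payers is an (A)-end pair of `(S₁, S₂)` (…EndRowDefsA). -/
theorem isEndPairA_of_rootMove {X : Finset E3} {v : WordVersion} {S₁ S₂ : PlateSystem} {G : E3 ≃ₗᵢ[ℝ] E3} {c b q : E3}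
    (hadm : S₁.Adm G c ∨ S₂.Adm G c) (hq : q ∈ X) (hb : b ∈ X) (hpay : HasTwoPayers X b) (hpred : q - c ∈ X)
    (hmove : IsEndMove X v G c q b) : IsEndPairA X v S₁ S₂ b q :=
  ⟨hq, hb, hpay, G, c, hadm, hpred, hmove⟩

end Summit.Ventures.Crystal3D.Theorems

end
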